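import Mathlib
import HarnessLib
import Summits.HubbardSuperconductivity.HubbardSuperconductivity.Theorems.KLProgrammeH10TwoPointLimitFrameAnchoredSectorCountThin
import Summits.HubbardSuperconductivity.HubbardSuperconductivity.Theorems.KLProgrammeH10TwoPointLimitFrameTorusBridge

/-!
# Route `KLProgramme` — K3 engine child `KLRegimeEngineV17F2` (stmt-HubbardSuperconductivity-20437), stub (b) import ι₂:
# THE LOG-FREE ANCHORED COUNT OF THE ENGINE'S ANISOTROPIC SECTOR CONSTRAINT SET `bgmSectorSet (klAnisoFamily … n) 4`

Cell gate-hubbard-kl, plan g17 (R41)(i) «E1-P2-THIN-COUNT» (seat p4; file 5, final layer).  The engine's one-sector-fixed four-leg sum runs over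
`{Ω ∈ bgmSectorSet L M (klAnisoFamily L M β μ K e₀ n) 4 : Ω p = s}` — label tuples `((ω_i, σ_i), c_i)_{i<4}` (smooth anisotropic sector of
width `π/2ⁿ`, spin, charge) admitting TORUS momenta in the supports of the multipliers with `Σ_i s_{c_i} k⃗_i = 0` on `(ℤ/Lℤ)²` (BGM 2006
(2.73)).  Its cardinality is `≤ C · sectorCount n`, `C` uniform in the frame (`FrameOK`, KL regime), `β, U, c, L, M`, the anchor leg `p` and its
label — no `|h|` factor (isotropic (2.80) / Lemma 3.1 have `γ^{-h}|h|`; Mastropietro 2008 (14.67)) — by reduction to `anchoredSectorCount_thin_frameOK`: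
§1 torus ⇒ square (signed centred representatives `q_i = ±c(k⃗_i) ∈ [-π, π]²` sum to `2πG`, `|G_j| ≤ 2`); §2 smooth label ⇒ sharp index of the
SIGNED momentum among six residues `ω + e·2ⁿ + d` (antipode = half the sectors); §3 the leg dictionary (support ⇒ thin frame shell
`|e_K(q)| ≤ (e₀/π²)w_n²` and §2); §4 the count: `6⁴·25` pieces (shifts per leg, `G`), each injecting up to the `4³` spins/charges of the free
legs into the admissible sharp triples (legs permuted by the transposition `(0 p)`): **`card_bgmSectorSet_klAniso_anchored_le_linear`**.
Everything is PROVED; no definitions, no named facts.  References: BGM 2006 §2.5 (2.45)–(2.48), §2.8 (2.73), (2.76)–(2.80), Lemma 3.1, App. A3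
[cite: BenfattoGiulianiMastropietro2006]; Mastropietro 2008 (14.67) p. 223 [cite: Mastropietro2008].
-/

noncomputable section

namespace Summit.HubbardSuperconductivity.HubbardSuperconductivity.Theorems.PerturbedFermiCurve

set_option linter.dupNamespace false -- summit = problem name (single-conjunct summit), D-0017

open Classical
open Real Set Finset
open Literature.MathematicalPhysics.QuantumLattice Literature.MathematicalPhysics.QuantumLattice.BandSectorCounting
open Literature.Probability.LatticeModels
open Summit.HubbardSuperconductivity.HubbardSuperconductivity.Theorems.DispersionFlow
open Summit.HubbardSuperconductivity.HubbardSuperconductivity.Theorems.KLRegimeSplit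
open Summit.HubbardSuperconductivity.HubbardSuperconductivity.Theorems.KLProgrammeLegKernels

/-! ## §1 Momentum conservation on the torus, read on signed centred representatives -/

/-- **Signed torus momenta summing to zero have signed centred representatives summing to a reciprocal vector**: if
`Σ_i s_{c_i} k⃗_i = 0` in `(ℤ/Lℤ)²` then `Σ_i ±c(k⃗_i) = 2πG` for some `G ∈ ℤ²` (`c = latticeMomentum + 2πm`, `latticeMomentum = 2π·val/L`,
and `L ∣ Σ_i ± val`). [cite: BenfattoGiulianiMastropietro2006, §2.8 (2.73)] -/
theorem exists_sum_signed_torusCentredMomentum_eq (L : ℕ) [NeZero L] {m : ℕ} (c : Fin m → Fin 2) (k : Fin m → TorusSite 2 L)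
    (h : ∑ i, signedMomentum L (c i) (k i) = 0) :
    ∃ G : Fin 2 → ℤ, ∀ j, ∑ i, (if c i = 0 then torusCentredMomentum L (k i) j else -torusCentredMomentum L (k i) j) =
      2 * π * (G j : ℝ) := by
  choose mv hmv using fun i => exists_torusCentredMomentum_eq_add L (k i)
  have hcomp : ∀ j, ∑ i, signedMomentum L (c i) (k i) j = 0 := fun j => by
    simpa only [Finset.sum_apply, Pi.zero_apply] using congrFun h j
  have hz : ∀ j, ((∑ i, (if c i = 0 then (1 : ℤ) else -1) * (((k i j).val : ℕ) : ℤ) : ℤ) : ZMod L) = 0 := by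
    intro j
    rw [← hcomp j]; push_cast
    refine Finset.sum_congr rfl fun i _ => ?_
    rw [ZMod.natCast_zmod_val]; unfold signedMomentum; split_ifs <;> simp
  have hdvd : ∀ j, (L : ℤ) ∣ ∑ i, (if c i = 0 then (1 : ℤ) else -1) * (((k i j).val : ℕ) : ℤ) := fun j =>
    (ZMod.intCast_zmod_eq_zero_iff_dvd _ L).1 (hz j)
  choose q hq using hdvd
  refine ⟨fun j => q j + ∑ i, (if c i = 0 then (1 : ℤ) else -1) * mv i j, fun j => ?_⟩
  have hL : (L : ℝ) ≠ 0 := by exact_mod_cast NeZero.ne L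
  have hterm : ∀ i, (if c i = 0 then torusCentredMomentum L (k i) j else -torusCentredMomentum L (k i) j) =
      (if c i = 0 then (1 : ℝ) else -1) * (((k i j).val : ℕ) : ℝ) * (2 * π / L) +
        2 * π * ((if c i = 0 then (1 : ℝ) else -1) * (mv i j : ℝ)) := by
    intro i; rw [hmv i]; simp only [latticeMomentum]; split_ifs <;> ring
  have hqR : ∑ i, (if c i = 0 then (1 : ℝ) else -1) * (((k i j).val : ℕ) : ℝ) = (L : ℝ) * (q j : ℝ) := by
    have := congrArg (fun z : ℤ => (z : ℝ)) (hq j); push_cast at this; exact this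
  rw [Finset.sum_congr rfl fun i _ => hterm i, Finset.sum_add_distrib, ← Finset.sum_mul, ← Finset.mul_sum, hqR]
  push_cast; field_simp

/-- The signed centred representatives lie in the closed square `[-π, π]²`. [folklore] -/
theorem abs_signed_torusCentredMomentum_le_pi (L : ℕ) (c : Fin 2) (k : TorusSite 2 L) (j : Fin 2) :
    |(if c = 0 then torusCentredMomentum L k j else -torusCentredMomentum L k j)| ≤ π := by
  split_ifs
  · exact abs_torusCentredMomentum_le_pi L k j
  · rw [abs_neg]; exact abs_torusCentredMomentum_le_pi L k j

/-- A reciprocal vector `2πG` reached by four momenta of the closed square has `|G_j| ≤ 2`. [folklore] -/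
theorem abs_le_two_of_sum_eq {q : Fin 4 → Fin 2 → ℝ} (hq : ∀ i j, |q i j| ≤ π) {G : Fin 2 → ℤ}
    (hG : ∀ j, ∑ i, q i j = 2 * π * (G j : ℝ)) (j : Fin 2) : |G j| ≤ 2 := by
  have h1 : |∑ i, q i j| ≤ 4 * π := by
    refine (Finset.abs_sum_le_sum_abs _ _).trans ?_
    calc ∑ i, |q i j| ≤ ∑ _i : Fin 4, π := Finset.sum_le_sum fun i _ => hq i j
      _ = 4 * π := by simp
  rw [hG j, abs_mul, abs_of_pos Real.two_pi_pos] at h1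
  have h2 : |(G j : ℝ)| ≤ 2 := by nlinarith [Real.pi_pos, abs_nonneg (G j : ℝ)]
  exact_mod_cast h2

/-! ## §2 Smooth label ⇒ sharp index of the signed momentum -/

/-- **Sharp index within one from the support inequality**: `|θ − (ω + ½)w − 2πk| < ¾w ⇒ sectorIndex n θ ≡ ω + d (mod N)`, `|d| ≤ 1`.
[cite: BenfattoGiulianiMastropietro2006, §2.5 (2.45)] -/
theorem sectorIndex_near_of_abs_lt {n : ℕ} {ω : ℤ} {θ : ℝ} (k : ℤ)
    (hk : |θ - ((ω : ℝ) + 1 / 2) * sectorWidth n - 2 * π * k| < 3 * sectorWidth n / 4) :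
    ∃ d : ℤ, |d| ≤ 1 ∧ (sectorCount n : ℤ) ∣ ((sectorIndex n θ : ℤ) - ω - d) :=
  sectorIndex_near_of_sectorWeightCirc_ne_zero (sectorWeightCirc_pos_of_abs_lt k hk).ne'

/-- `2ⁿ · w_n = π`. [folklore] -/
theorem two_pow_mul_sectorWidth (n : ℕ) : (2 : ℝ) ^ n * sectorWidth n = π := by
  unfold sectorWidth; field_simp

/-- **The antipode shifts the support inequality by half the sectors**: for `z ≠ 0`, `arg(−z) ≡ arg z + π (mod 2π)`, so
`|arg z − (ω + ½)w − 2πk| < ¾w ⇒ |arg(−z) − (ω + 2ⁿ + ½)w − 2πk′| < ¾w` for some `k′`. [folklore] -/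
theorem abs_arg_neg_sub_lt {n : ℕ} {ω : ℤ} {z : ℂ} (hz : z ≠ 0) {k : ℤ}
    (hk : |Complex.arg z - ((ω : ℝ) + 1 / 2) * sectorWidth n - 2 * π * k| < 3 * sectorWidth n / 4) :
    ∃ k' : ℤ, |Complex.arg (-z) - (((ω + 2 ^ n : ℤ) : ℝ) + 1 / 2) * sectorWidth n - 2 * π * k'| < 3 * sectorWidth n / 4 := by
  have h := Complex.arg_neg_coe_angle hz
  rw [← Real.Angle.coe_add, Real.Angle.angle_eq_iff_two_pi_dvd_sub] at h
  obtain ⟨m, hm⟩ := h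
  refine ⟨k + m, ?_⟩
  have hw := two_pow_mul_sectorWidth n
  have e : Complex.arg (-z) - (((ω + 2 ^ n : ℤ) : ℝ) + 1 / 2) * sectorWidth n - 2 * π * ((k + m : ℤ) : ℝ) =
      Complex.arg z - ((ω : ℝ) + 1 / 2) * sectorWidth n - 2 * π * k := by
    push_cast
    linear_combination hm - hw
  rw [e]; exact hk

/-- **Smooth label ⇒ the sharp index of the signed momentum is one of six residues**: if `ζ̃_{n,ω}(arg z) ≠ 0` (`N = sectorCount n`)
then for either charge `c` the sharp index of the signed momentum (`z` for `c = 0`, `−z` for `c = 1`) is `(ω + e·2ⁿ + d + N − 1) mod N` for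
some `e ∈ {0, 1}`, `d ∈ {0, 1, 2}` (the antipodal shift `e = 1` occurs only for `c = 1`, `z ≠ 0`; stated uniformly).
[cite: BenfattoGiulianiMastropietro2006, §2.5 (2.45)] -/
theorem sectorIndex_signed_eq_mod {n ω : ℕ} {z : ℂ} (h : sectorWeightCirc n (ω : ℤ) (Complex.arg z) ≠ 0) (c : Fin 2) :
    ∃ e : Fin 2, ∃ d : Fin 3, sectorIndex n (Complex.arg (if c = 0 then z else -z)) =
      (ω + (e : ℕ) * 2 ^ n + (d : ℕ) + (sectorCount n - 1)) % sectorCount n := by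
  -- conversion from the divisibility form
  have conv : ∀ (θ : ℝ) (e : Fin 2) (d : ℤ), |d| ≤ 1 →
      ((sectorCount n : ℤ) ∣ ((sectorIndex n θ : ℤ) - ((ω : ℤ) + (e : ℕ) * 2 ^ n) - d)) →
      ∃ d' : Fin 3, sectorIndex n θ = (ω + (e : ℕ) * 2 ^ n + (d' : ℕ) + (sectorCount n - 1)) % sectorCount n := by
    intro θ e d hd hdiv
    set N := sectorCount n with hN
    have hN1 : 1 ≤ N := sectorCount_pos n
    have hd' : 0 ≤ d + 1 ∧ d + 1 < 3 := by rw [abs_le] at hd; omega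
    refine ⟨⟨(d + 1).toNat, by omega⟩, ?_⟩
    have hcast : (((d + 1).toNat : ℕ) : ℤ) = d + 1 := Int.toNat_of_nonneg hd'.1
    have hlt : sectorIndex n θ < N := sectorIndex_lt n θ
    obtain ⟨t, ht⟩ := hdiv
    have key : ((ω + (e : ℕ) * 2 ^ n + ((d + 1).toNat : ℕ) + (N - 1) : ℕ) : ℤ) = (sectorIndex n θ : ℤ) + N * (1 - t) := by
      push_cast [Nat.cast_sub hN1, hcast]
      linear_combination (-1 : ℤ) * ht
    have hmod : (((ω + (e : ℕ) * 2 ^ n + ((d + 1).toNat : ℕ) + (N - 1)) % N : ℕ) : ℤ) = (sectorIndex n θ : ℤ) := by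
      rw [Int.natCast_mod, key, Int.add_mul_emod_self_left]
      exact Int.emod_eq_of_lt (by positivity) (by exact_mod_cast hlt)
    exact_mod_cast hmod.symm
  obtain ⟨k, hk⟩ := exists_abs_lt_of_sectorWeightCirc_ne_zero h
  by_cases hc : c = 0
  · obtain ⟨d, hd, hdiv⟩ := sectorIndex_near_of_abs_lt k hk
    obtain ⟨d', hd'⟩ := conv (Complex.arg z) 0 d hd (by simpa using hdiv)
    exact ⟨0, d', by rw [if_pos hc]; exact hd'⟩
  · by_cases hz : z = 0
    · obtain ⟨d, hd, hdiv⟩ := sectorIndex_near_of_abs_lt k hk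
      obtain ⟨d', hd'⟩ := conv (Complex.arg z) 0 d hd (by simpa using hdiv)
      refine ⟨0, d', ?_⟩
      rw [if_neg hc, hz, neg_zero]; rw [hz] at hd'; exact hd'
    · obtain ⟨k', hk'⟩ := abs_arg_neg_sub_lt (n := n) hz hk
      obtain ⟨d, hd, hdiv⟩ := sectorIndex_near_of_abs_lt k' hk'
      obtain ⟨d', hd'⟩ := conv (Complex.arg (-z)) 1 d hd (by simpa using hdiv)
      exact ⟨1, d', by rw [if_neg hc]; exact hd'⟩

/-! ## §3 The leg dictionary: support of the anisotropic multiplier ⇒ thin frame shell and sharp index of the signed momentum -/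

/-- `klScale e₀ n = (e₀/π²)·w_n²`: the engine's shell `|e_K| < e₀ 4^{-n}` is the thin shell with thickness constant `c_T = e₀/π²`. [folklore] -/
theorem klScale_eq_mul_sectorWidth_sq (e₀ : ℝ) (n : ℕ) : klScale e₀ n = e₀ / π ^ 2 * sectorWidth n ^ 2 := by
  unfold klScale sectorWidth
  have hπ : (π : ℝ) ≠ 0 := Real.pi_ne_zero
  have h4 : (4 : ℝ) ^ n = ((2 : ℝ) ^ n) ^ 2 := by rw [← pow_mul, mul_comm, pow_mul]; norm_num
  rw [h4, div_pow]; field_simp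

/-- The frame level function is even on the square: `e_K(−k) = e_K(k)`. [folklore] -/
theorem frameLevel_toLp_neg (μ : ℝ) (K : TrigPolyC4v) (k : Fin 2 → ℝ) :
    frameLevel μ K (WithLp.toLp 2 (-k)) = frameLevel μ K (WithLp.toLp 2 k) := by
  have hev : sqDispersion (-k) = sqDispersion k := by simp [sqDispersion, Real.cos_neg]
  rw [frameLevel_toLp, frameLevel_toLp, hev, frameShift_toLp_neg]

/-- **Leg dictionary, shell**: a leg carrying `klAnisoFamily … klE0 n ω` at `k` has its signed centred momentum `q = ±c(k⃗)` in the thin frame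
shell `|e_K(q)| ≤ (klE0/π²)·w_n²`. [cite: BenfattoGiulianiMastropietro2006, §2.5 (2.45)–(2.48)] -/
theorem leg_thin_shell (L M : ℕ) {β μ : ℝ} {K : TrigPolyC4v} {n : ℕ} {ω : Fin (sectorCount n)} {k : FreqMomentum L M}
    (h : klAnisoFamily L M β μ K klE0 n ω k ≠ 0) (c : Fin 2) :
    |frameLevel μ K (WithLp.toLp 2
        (fun j => if c = 0 then torusCentredMomentum L k.2 j else -torusCentredMomentum L k.2 j))| ≤
      klE0 / π ^ 2 * sectorWidth n ^ 2 := by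
  have he : (0 : ℝ) < klE0 := by norm_num [klE0]
  obtain ⟨h1, -, -⟩ := support_klAnisoFamily L M he β μ K n ω k h
  rw [nambuXiCT_eq_frameLevel, klScale_eq_mul_sectorWidth_sq] at h1
  by_cases hc : c = 0
  · simp only [hc, if_true]; exact h1.le
  · simp only [hc, if_false]
    have hfun : (fun j => -torusCentredMomentum L k.2 j) = -torusCentredMomentum L k.2 := rfl
    rw [hfun, frameLevel_toLp_neg]; exact h1.le

/-- **Leg dictionary, sector**: a leg `((ω, σ), c)` carrying `klAnisoFamily … klE0 n ω` at `k` has the sharp index of its signed centred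
momentum among the six residues `(ω + e·2ⁿ + d + N − 1) mod N`, `e < 2`, `d < 3`. [cite: BenfattoGiulianiMastropietro2006, §2.5 (2.45)] -/
theorem leg_sharp_index (L M : ℕ) {β μ : ℝ} {K : TrigPolyC4v} {n : ℕ} {ω : Fin (sectorCount n)} {k : FreqMomentum L M}
    (h : klAnisoFamily L M β μ K klE0 n ω k ≠ 0) (c : Fin 2) :
    ∃ e : Fin 2, ∃ d : Fin 3, sectorIndex n (Complex.arg
        (⟨(if c = 0 then torusCentredMomentum L k.2 0 else -torusCentredMomentum L k.2 0),
          (if c = 0 then torusCentredMomentum L k.2 1 else -torusCentredMomentum L k.2 1)⟩ : ℂ)) =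
      ((ω : ℕ) + (e : ℕ) * 2 ^ n + (d : ℕ) + (sectorCount n - 1)) % sectorCount n := by
  have he : (0 : ℝ) < klE0 := by norm_num [klE0]
  obtain ⟨-, -, h3⟩ := support_klAnisoFamily L M he β μ K n ω k h
  rw [momentumAngle_eq_arg] at h3
  have hz : (⟨(if c = 0 then torusCentredMomentum L k.2 0 else -torusCentredMomentum L k.2 0),
      (if c = 0 then torusCentredMomentum L k.2 1 else -torusCentredMomentum L k.2 1)⟩ : ℂ) =
      if c = 0 then (⟨torusCentredMomentum L k.2 0, torusCentredMomentum L k.2 1⟩ : ℂ)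
      else -(⟨torusCentredMomentum L k.2 0, torusCentredMomentum L k.2 1⟩ : ℂ) := by
    split_ifs
    · rfl
    · exact Complex.ext (by simp) (by simp)
  rw [hz]; exact sectorIndex_signed_eq_mod h3 c

/-! ## §4 The anchored thin anisotropic count -/

/-- **THE ANCHORED, LOG-FREE COUNT OF THE ENGINE'S ANISOTROPIC SECTOR CONSTRAINT SET («E1-P2-THIN-COUNT»).**  For every level window
`[μ₁, μ₂] ⊂ (-4, 0)` there is `C` (geometric: fixed BEFORE `R`), and for every `R` thresholds `c₃, U₀ > 0`, such that for all `0 < c ≤ c₃`,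
`0 < U ≤ U₀`, `klBetaMin ≤ β ≤ e^{c/U²}`,
`μ ∈ [μ₁, μ₂]`, every frame with `FrameOK R U (nScales β) ν K`, every torus `L ≥ 1`, cutoff `M`, scale `n`, anchor leg `p` and label `s`:
`#{Ω ∈ bgmSectorSet L M (klAnisoFamily L M β μ K klE0 n) 4 : Ω p = s} ≤ C · sectorCount n` — linear in the number of ANISOTROPIC sectors of
width `π/2ⁿ`, with NO `|h| = n` factor (the isotropic (2.80) / Lemma 3.1 carry `γ^{-h}|h|`; Mastropietro 2008 (14.67)).
[cite: BenfattoGiulianiMastropietro2006, §2.8 (2.73), (2.76)–(2.80), Lemma 3.1, App. A3] -/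
theorem card_bgmSectorSet_klAniso_anchored_le_linear :
    ∀ μ₁ μ₂ : ℝ, -4 < μ₁ → μ₁ ≤ μ₂ → μ₂ < 0 → ∃ C : ℝ, 0 < C ∧ ∀ R : RenConsts, (∀ j, 0 ≤ R.Gfr j) →
      ∃ c₃ : ℝ, 0 < c₃ ∧ ∃ U₀ : ℝ, 0 < U₀ ∧
      ∀ c : ℝ, 0 < c → c ≤ c₃ → ∀ U : ℝ, 0 < U → U ≤ U₀ → ∀ β : ℝ, klBetaMin ≤ β → β ≤ Real.exp (c / U ^ 2) →
      ∀ μ ∈ Set.Icc μ₁ μ₂, ∀ (ν : ℝ) (K : TrigPolyC4v), FrameOK R U (nScales β) ν K →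
      ∀ (L M : ℕ) [NeZero L] (n : ℕ) (p : Fin 4) (s : SectorLeg (sectorCount n)),
      ((((bgmSectorSet L M (klAnisoFamily L M β μ K klE0 n) 4).filter
          (fun Ω : Fin 4 → SectorLeg (sectorCount n) => Ω p = s)).card : ℕ) : ℝ) ≤ C * sectorCount n := by
  intro μ₁ μ₂ hμ₁ h12 hμ₂
  have he0 : (0 : ℝ) < klE0 := by norm_num [klE0]
  obtain ⟨Kc, hKc, hKR⟩ := anchoredSectorCount_thin_frameOK μ₁ μ₂ (klE0 / π ^ 2) hμ₁ h12 hμ₂ (by positivity)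
  refine ⟨32400 * 64 * Kc, by positivity, fun R hR => ?_⟩
  obtain ⟨c₃, hc₃, U₀, hU₀, hcount⟩ := hKR R hR
  refine ⟨c₃, hc₃, U₀, hU₀, ?_⟩
  intro c hc hcle U hU hUle β hβmin hβc μ hμ ν K hK L M _ n p s
  have hC := hcount c hc hcle U hU hUle β hβmin hβc μ hμ ν K hK n
  have hNpos : 0 < sectorCount n := sectorCount_pos n
  -- the transposition `(0 p)` of the legs
  obtain ⟨τ, hτdef⟩ : ∃ τ : Equiv.Perm (Fin 4), τ = Equiv.swap 0 p := ⟨_, rfl⟩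
  have hτ0 : τ 0 = p := by rw [hτdef]; exact Equiv.swap_apply_left 0 p
  have hττ : ∀ i, τ (τ i) = i := fun i => by rw [hτdef]; exact Equiv.swap_apply_self 0 p i
  -- the six candidate sharp indices of a label: `(ω + e·2ⁿ + d + N − 1) mod N`, `(e, d) ∈ Fin 2 × Fin 3`
  obtain ⟨sh, hshdef⟩ : ∃ sh : Fin 2 × Fin 3 → SectorLeg (sectorCount n) → Fin (sectorCount n),
      ∀ ed lam, (sh ed lam : ℕ) = ((lam.1.1 : ℕ) + (ed.1 : ℕ) * 2 ^ n + (ed.2 : ℕ) + (sectorCount n - 1)) % sectorCount n :=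
    ⟨fun ed lam => ⟨((lam.1.1 : ℕ) + (ed.1 : ℕ) * 2 ^ n + (ed.2 : ℕ) + (sectorCount n - 1)) % sectorCount n,
      Nat.mod_lt _ hNpos⟩, fun _ _ => rfl⟩
  have hsh_inj : ∀ (ed : Fin 2 × Fin 3) (lam lam' : SectorLeg (sectorCount n)), sh ed lam = sh ed lam' →
      lam.1.2 = lam'.1.2 → lam.2 = lam'.2 → lam = lam' := by
    intro ed lam lam' h1 h2 h3
    have h1' : ((lam.1.1 : ℕ) + ((ed.1 : ℕ) * 2 ^ n + (ed.2 : ℕ) + (sectorCount n - 1))) % sectorCount n =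
        ((lam'.1.1 : ℕ) + ((ed.1 : ℕ) * 2 ^ n + (ed.2 : ℕ) + (sectorCount n - 1))) % sectorCount n := by
      have := congrArg Fin.val h1
      rw [hshdef, hshdef] at this
      simpa only [add_assoc] using this
    have hmod : (lam.1.1 : ℕ) ≡ (lam'.1.1 : ℕ) [MOD sectorCount n] := Nat.ModEq.add_right_cancel' _ h1'
    have heq : (lam.1.1 : ℕ) = (lam'.1.1 : ℕ) := Nat.ModEq.eq_of_lt_of_lt hmod lam.1.1.isLt lam'.1.1.isLt
    exact Prod.ext (Prod.ext (Fin.ext heq) h2) h3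
  -- the admissible sharp triples of the frame count (anchor index `ω₁`, reciprocal vector `G`)
  obtain ⟨Adm, hAdmdef⟩ : ∃ Adm : Fin (sectorCount n) → (Fin 2 → ℤ) →
      Finset (Fin (sectorCount n) × Fin (sectorCount n) × Fin (sectorCount n)), ∀ ω₁ G, Adm ω₁ G =
    (Finset.univ : Finset (Fin (sectorCount n) × Fin (sectorCount n) × Fin (sectorCount n))).filter
      (fun ω : Fin (sectorCount n) × Fin (sectorCount n) × Fin (sectorCount n) =>
      ∃ k : Fin 4 → Fin 2 → ℝ, (∀ j i, |k j i| ≤ Real.pi) ∧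
        (∀ j, |frameLevel μ K (WithLp.toLp 2 (k j))| ≤ klE0 / π ^ 2 * sectorWidth n ^ 2) ∧
        sectorIndex n (Complex.arg (⟨k 0 0, k 0 1⟩ : ℂ)) = (ω₁ : ℕ) ∧
        sectorIndex n (Complex.arg (⟨k 1 0, k 1 1⟩ : ℂ)) = (ω.1 : ℕ) ∧
        sectorIndex n (Complex.arg (⟨k 2 0, k 2 1⟩ : ℂ)) = (ω.2.1 : ℕ) ∧
        sectorIndex n (Complex.arg (⟨k 3 0, k 3 1⟩ : ℂ)) = (ω.2.2 : ℕ) ∧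
        (∀ i, ∑ j, k j i = 2 * Real.pi * (G i : ℝ))) := ⟨_, fun _ _ => rfl⟩
  have hAdm : ∀ ω₁ G, ((Adm ω₁ G).card : ℝ) ≤ Kc * 2 ^ n := fun ω₁ G => by rw [hAdmdef]; exact hC G ω₁
  -- reciprocal vectors `|G_j| ≤ 2`, parametrised by `Fin 5 × Fin 5`
  obtain ⟨Gof, hGofdef⟩ : ∃ Gof : Fin 5 × Fin 5 → Fin 2 → ℤ, ∀ g i,
      Gof g i = if i = 0 then ((g.1 : ℕ) : ℤ) - 2 else ((g.2 : ℕ) : ℤ) - 2 := ⟨fun g i => _, fun _ _ => rfl⟩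
  -- the pieces
  obtain ⟨S, hSdef⟩ : ∃ S : (Fin 4 → Fin 2 × Fin 3) × (Fin 5 × Fin 5) → Finset (Fin 4 → SectorLeg (sectorCount n)),
      ∀ par, S par = (Finset.univ : Finset (Fin 4 → SectorLeg (sectorCount n))).filter
        (fun Ω : Fin 4 → SectorLeg (sectorCount n) => Ω p = s ∧
        (sh (par.1 (τ 1)) (Ω (τ 1)), sh (par.1 (τ 2)) (Ω (τ 2)), sh (par.1 (τ 3)) (Ω (τ 3))) ∈
          Adm (sh (par.1 p) s) (Gof par.2)) := ⟨_, fun _ => rfl⟩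
  -- (1) COVER: every admissible `Ω` lies in a piece
  have hcover : (bgmSectorSet L M (klAnisoFamily L M β μ K klE0 n) 4).filter
      (fun Ω : Fin 4 → SectorLeg (sectorCount n) => Ω p = s) ⊆ Finset.univ.biUnion S := by
    intro Ω hΩ
    simp only [Finset.mem_biUnion, Finset.mem_univ, true_and]
    rw [Finset.mem_filter, mem_bgmSectorSet] at hΩ
    have hΩp : Ω p = s := hΩ.2
    obtain ⟨kf, hkF, hsum⟩ := hΩ.1
    -- signed centred momenta of the legs
    obtain ⟨q, hqdef⟩ : ∃ q : Fin 4 → Fin 2 → ℝ, ∀ i j, q i j =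
        if (Ω i).2 = 0 then torusCentredMomentum L (kf i).2 j else -torusCentredMomentum L (kf i).2 j :=
      ⟨_, fun _ _ => rfl⟩
    have hqfun : ∀ i, q i = fun j =>
        if (Ω i).2 = 0 then torusCentredMomentum L (kf i).2 j else -torusCentredMomentum L (kf i).2 j :=
      fun i => funext (hqdef i)
    have hqabs : ∀ i j, |q i j| ≤ π := fun i j => by
      rw [hqdef]; exact abs_signed_torusCentredMomentum_le_pi L (Ω i).2 (kf i).2 j
    have hqlev : ∀ i, |frameLevel μ K (WithLp.toLp 2 (q i))| ≤ klE0 / π ^ 2 * sectorWidth n ^ 2 := fun i => by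
      rw [hqfun]; exact leg_thin_shell L M (hkF i) (Ω i).2
    have hqidx : ∀ i, ∃ ed : Fin 2 × Fin 3, sectorIndex n (Complex.arg (⟨q i 0, q i 1⟩ : ℂ)) = (sh ed (Ω i) : ℕ) := by
      intro i
      obtain ⟨e, d, hed⟩ := leg_sharp_index L M (hkF i) (Ω i).2
      refine ⟨(e, d), ?_⟩
      rw [hshdef, hqdef, hqdef]
      exact hed
    choose ed hed using hqidx
    obtain ⟨G, hG⟩ := exists_sum_signed_torusCentredMomentum_eq L (fun i => (Ω i).2) (fun i => (kf i).2) hsum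
    have hGq : ∀ j, ∑ i, q i j = 2 * π * (G j : ℝ) := fun j => by
      rw [← hG j]
      exact Finset.sum_congr rfl fun i _ => hqdef i j
    have hGabs : ∀ j, |G j| ≤ 2 := abs_le_two_of_sum_eq hqabs hGq
    have hG0 := hGabs 0
    have hG1 := hGabs 1
    rw [abs_le] at hG0 hG1
    -- the parameters of the piece
    obtain ⟨g, hg⟩ : ∃ g : Fin 5 × Fin 5, Gof g = G := by
      refine ⟨(⟨(G 0 + 2).toNat, by omega⟩, ⟨(G 1 + 2).toNat, by omega⟩), funext fun i => ?_⟩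
      have e0 : (((G 0 + 2).toNat : ℕ) : ℤ) = G 0 + 2 := Int.toNat_of_nonneg (by omega)
      have e1 : (((G 1 + 2).toNat : ℕ) : ℤ) = G 1 + 2 := Int.toNat_of_nonneg (by omega)
      rw [hGofdef]
      split_ifs with hi
      · rw [hi]
        simp only [e0]
        ring
      · have hi1 : i = 1 := by fin_cases i <;> first | rfl | exact absurd rfl hi
        rw [hi1]
        simp only [e1]
        ring
    refine ⟨(ed, g), ?_⟩
    rw [hSdef, Finset.mem_filter]
    refine ⟨Finset.mem_univ _, hΩp, ?_⟩
    rw [hg, hAdmdef, Finset.mem_filter]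
    refine ⟨Finset.mem_univ _, fun j => q (τ j), fun j i => hqabs _ _, fun j => hqlev _, ?_, hed (τ 1), hed (τ 2),
      hed (τ 3), fun i => ?_⟩
    · show sectorIndex n (Complex.arg (⟨q (τ 0) 0, q (τ 0) 1⟩ : ℂ)) = (sh (ed p) s : ℕ)
      rw [hτ0, ← hΩp]
      exact hed p
    · exact (Equiv.sum_comp τ (fun j => q j i)).trans (hGq i)
  -- (2) PIECES: each piece injects, up to the `4³` spin/charge choices of the free legs, into the admissible sharp triples
  have hpiece : ∀ par : (Fin 4 → Fin 2 × Fin 3) × (Fin 5 × Fin 5), ((S par).card : ℝ) ≤ 64 * (Kc * 2 ^ n) := by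
    intro par
    obtain ⟨f, hfdef⟩ : ∃ f : (Fin 4 → SectorLeg (sectorCount n)) → Fin (sectorCount n) × Fin (sectorCount n) × Fin (sectorCount n),
        ∀ Ω, f Ω = (sh (par.1 (τ 1)) (Ω (τ 1)), sh (par.1 (τ 2)) (Ω (τ 2)), sh (par.1 (τ 3)) (Ω (τ 3))) :=
      ⟨_, fun _ => rfl⟩
    have hmaps : ∀ Ω ∈ S par, f Ω ∈ Adm (sh (par.1 p) s) (Gof par.2) := by
      intro Ω hΩ
      rw [hSdef, Finset.mem_filter] at hΩ
      rw [hfdef]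
      exact hΩ.2.2
    have hfib : ∀ b ∈ Adm (sh (par.1 p) s) (Gof par.2), ((S par).filter (fun Ω => f Ω = b)).card ≤ 64 := by
      intro b _
      obtain ⟨sc, hscdef⟩ : ∃ sc : (Fin 4 → SectorLeg (sectorCount n)) → (Fin 2 × Fin 2) × (Fin 2 × Fin 2) × (Fin 2 × Fin 2),
          ∀ Ω, sc Ω = (((Ω (τ 1)).1.2, (Ω (τ 1)).2), ((Ω (τ 2)).1.2, (Ω (τ 2)).2), ((Ω (τ 3)).1.2, (Ω (τ 3)).2)) :=
        ⟨_, fun _ => rfl⟩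
      have hinj : Set.InjOn sc ↑((S par).filter (fun Ω => f Ω = b)) := by
        intro Ω hΩ Ω' hΩ' hsc
        rw [Finset.coe_filter, Set.mem_setOf_eq] at hΩ hΩ'
        have hΩS := hΩ.1
        have hΩ'S := hΩ'.1
        rw [hSdef, Finset.mem_filter] at hΩS hΩ'S
        have hff : f Ω = f Ω' := hΩ.2.trans hΩ'.2.symm
        rw [hfdef, hfdef, Prod.mk.injEq, Prod.mk.injEq] at hff
        rw [hscdef, hscdef, Prod.mk.injEq, Prod.mk.injEq, Prod.mk.injEq, Prod.mk.injEq, Prod.mk.injEq] at hsc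
        have h4 : ∀ m : Fin 4, Ω (τ m) = Ω' (τ m) := by
          intro m
          fin_cases m
          · show Ω (τ 0) = Ω' (τ 0)
            rw [hτ0, hΩS.2.1, hΩ'S.2.1]
          · exact hsh_inj _ _ _ hff.1 hsc.1.1 hsc.1.2
          · exact hsh_inj _ _ _ hff.2.1 hsc.2.1.1 hsc.2.1.2
          · exact hsh_inj _ _ _ hff.2.2 hsc.2.2.1 hsc.2.2.2
        funext i
        rw [← hττ i]
        exact h4 (τ i)
      calc ((S par).filter (fun Ω => f Ω = b)).card
          ≤ (Finset.univ : Finset ((Fin 2 × Fin 2) × (Fin 2 × Fin 2) × (Fin 2 × Fin 2))).card :=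
            Finset.card_le_card_of_injOn sc (fun _ _ => Finset.mem_coe.2 (Finset.mem_univ _)) hinj
        _ = 64 := by simp
    have hle := Finset.card_le_mul_card_image_of_maps_to hmaps 64 hfib
    calc ((S par).card : ℝ) ≤ ((64 * (Adm (sh (par.1 p) s) (Gof par.2)).card : ℕ) : ℝ) := by exact_mod_cast hle
      _ = 64 * ((Adm (sh (par.1 p) s) (Gof par.2)).card : ℝ) := by push_cast; ring
      _ ≤ 64 * (Kc * 2 ^ n) := mul_le_mul_of_nonneg_left (hAdm _ _) (by norm_num)
  -- (3) ASSEMBLY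
  have hsc2 : (2 : ℝ) ^ n ≤ ((sectorCount n : ℕ) : ℝ) := by
    rw [sectorCount]
    push_cast
    rw [pow_succ]
    linarith [pow_pos (by norm_num : (0 : ℝ) < 2) n]
  have hKN : 32400 * (64 * (Kc * (2 : ℝ) ^ n)) ≤ 32400 * 64 * Kc * ((sectorCount n : ℕ) : ℝ) := by
    have := mul_le_mul_of_nonneg_left hsc2 (by positivity : (0 : ℝ) ≤ 32400 * 64 * Kc)
    calc 32400 * (64 * (Kc * (2 : ℝ) ^ n)) = 32400 * 64 * Kc * 2 ^ n := by ring
      _ ≤ 32400 * 64 * Kc * ((sectorCount n : ℕ) : ℝ) := this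
  calc _ ≤ ((Finset.univ.biUnion S).card : ℝ) := by exact_mod_cast Finset.card_le_card hcover
    _ ≤ ∑ par, ((S par).card : ℝ) := by exact_mod_cast Finset.card_biUnion_le
    _ ≤ ∑ _par : (Fin 4 → Fin 2 × Fin 3) × (Fin 5 × Fin 5), 64 * (Kc * 2 ^ n) := Finset.sum_le_sum fun par _ => hpiece par
    _ = 32400 * (64 * (Kc * 2 ^ n)) := by
        simp only [Finset.sum_const, Finset.card_univ, Fintype.card_prod, Fintype.card_fun, Fintype.card_fin, nsmul_eq_mul]
        norm_num
    _ ≤ 32400 * 64 * Kc * ((sectorCount n : ℕ) : ℝ) := hKN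

end Summit.HubbardSuperconductivity.HubbardSuperconductivity.Theorems.PerturbedFermiCurve

end
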